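import Summits.Ventures.PercRepro.ProfilePointedCircuitClassesStarStarC

/-!
# PercRepro — THE SPANNING `5`-SETS OF `S ∪ Y` IN A RANK-`4` MATROID, IV: THE EXTRA LABELS PAID TO THE BAD POINTS
(p5, gen 41; `proofs/P5-GM1.md` §60)

Setting of part III: `{s₁, s₂} ⊆ S` a parallel pair, `K := S ∖ {s₁, s₂}`, `K + s₁` a basis, bad points `z` parallel
to `s₁`.  A bad point has only the two point labels `s₁, s₂`; the missing third label is paid by EXTRA labels of
pairs and triples that the counting of §60 does not otherwise use:

* a triple `Z ∋ z, y` with `y` non-bad (`K − m + s₁ + y` spanning) has the label `A = {s₁, s₂, m}`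
  (`one_le_card_filter_triple_of_bad_mem`); with two bad points it is dependent (`rk_triple_le_two_of_two_bad`);
* a pair `Z` has the label `{a, k}` (`a ∈ {s₁, s₂}`, `k ∈ K`) whenever `K − k + s₁ + Z` spans
  (`pair_mem_filter_of_rk_insert_eq_four`): two such `k` give four labels (`four_le_card_filter_pair_of_witnesses`),
  five with `{s₁, s₂}` (`five_le_card_filter_pair_of_witnesses`);
* a non-bad `y` with only ONE `m ∈ K` such that `K − m + s₁ + y` spans lies on the line `cl{s₁, m}`
  (`rk_insert_pair_le_two_of_unique`); two non-bad points on one line with a bad point form a dependent triple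
  (`rk_triple_le_two_of_same_line`), two on different lines an independent pair
  (`rk_pair_eq_two_of_different_lines`).
-/

open scoped Matroid

namespace PercRepro.Cogirth

open Finset ThmH Skew Shadow Profile

variable {α : Type} [DecidableEq α] {M : Matroid α} [M.Finite]

section StarStarD

/-! ### Triples with a bad point -/

/-- A triple with two bad points is dependent: `ρ{z, z', y} = ρ{s₁, y} ≤ 2`. -/
theorem rk_triple_le_two_of_two_bad (hll : ∀ x ∈ gr M, rk M {x} = 1) {s₁ z z' y : α} (hs₁ : s₁ ∈ gr M)
    (hz : z ∈ gr M) (hz' : z' ∈ gr M) (hy : y ∈ gr M) (hzb : rk M {s₁, z} ≤ 1) (hz'b : rk M {s₁, z'} ≤ 1) :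
    rk M {z, z', y} ≤ 2 := by
  have h1 := rk_insert_eq_of_parallel hll hz hs₁ (by rw [pair_comm]; exact hzb)
    (X := {z', y}) (insert_subset hz' (singleton_subset_iff.2 hy))
  have h2 := rk_insert_eq_of_parallel hll hz' hs₁ (by rw [pair_comm]; exact hz'b)
    (X := {s₁, y}) (insert_subset hs₁ (singleton_subset_iff.2 hy))
  have h3 : rk M {s₁, y} ≤ 2 := (rk_le_card _).trans card_le_two
  have e : insert s₁ ({z', y} : Finset α) = insert z' {s₁, y} := insert_comm _ _ _
  rw [insert_eq_of_mem (mem_insert_self s₁ {y})] at h2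
  calc rk M {z, z', y} = rk M (insert s₁ {z', y}) := h1
    _ = rk M (insert z' {s₁, y}) := by rw [e]
    _ = rk M {s₁, y} := h2
    _ ≤ 2 := h3

/-- **The triple label `{s₁, s₂, m}`**: for a bad `z` and a point `y` with `K − m + s₁ + y` spanning, every triple
`Z ∋ z, y` has `(S ∖ {s₁, s₂, m}) ∪ Z ⊇ (K − m) + z + y` spanning. -/
theorem one_le_card_filter_triple_of_bad_mem (hR : rk M (gr M) = 4) (hll : ∀ x ∈ gr M, rk M {x} = 1)
    {S : Finset α} (hS : S ⊆ gr M) {s₁ s₂ : α} (hs₁ : s₁ ∈ S) (hs₂ : s₂ ∈ S) (hne : s₁ ≠ s₂) {z y : α}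
    (hz : z ∈ gr M) (hzb : rk M {s₁, z} ≤ 1) {m : α} (hm : m ∈ S \ {s₁, s₂})
    (hym : rk M (insert y (insert s₁ ((S \ {s₁, s₂}).erase m))) = 4) {Z : Finset α} (hZ : Z ⊆ gr M)
    (hzZ : z ∈ Z) (hyZ : y ∈ Z) :
    1 ≤ ((S.powersetCard 3).filter (fun A => rk M ((S \ A) ∪ Z) = 4)).card := by
  have hmS : m ∈ S := (mem_sdiff.1 hm).1
  have hm12 : m ∉ ({s₁, s₂} : Finset α) := (mem_sdiff.1 hm).2
  have hm1 : m ≠ s₁ := fun h => hm12 (h ▸ mem_insert_self _ _)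
  have hm2 : m ≠ s₂ := fun h => hm12 (h ▸ mem_insert_of_mem (mem_singleton_self _))
  apply card_pos.2
  refine ⟨{s₁, s₂, m}, ?_⟩
  rw [mem_filter, mem_powersetCard]
  refine ⟨⟨?_, ?_⟩, ?_⟩
  · intro x hx
    rw [mem_insert, mem_insert, mem_singleton] at hx
    rcases hx with h | h | h <;> rw [h] <;> assumption
  · rw [card_insert_of_notMem, card_pair hm2.symm]
    rw [mem_insert, mem_singleton, not_or]
    exact ⟨hne, hm1.symm⟩
  · have hKg : (S \ {s₁, s₂}).erase m ⊆ gr M := (erase_subset _ _).trans (sdiff_subset.trans hS)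
    have hsub : insert z (insert y ((S \ {s₁, s₂}).erase m)) ⊆ (S \ {s₁, s₂, m}) ∪ Z := by
      intro x hx
      rw [mem_insert, mem_insert, mem_erase, mem_sdiff, mem_insert, mem_singleton, not_or] at hx
      rw [mem_union, mem_sdiff, mem_insert, mem_insert, mem_singleton, not_or, not_or]
      rcases hx with h | h | ⟨hxm, hxS, hx1, hx2⟩
      · rw [h]; exact Or.inr hzZ
      · rw [h]; exact Or.inr hyZ
      · exact Or.inl ⟨hxS, hx1, hx2, hxm⟩
    have h1 := rk_mono' (M := M) hsub
    have h2 := rk_insert_eq_of_parallel hll hz (hS hs₁) (by rw [pair_comm]; exact hzb)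
      (X := insert y ((S \ {s₁, s₂}).erase m)) (insert_subset (hZ hyZ) hKg)
    rw [insert_comm s₁ y, hym] at h2
    have h3 : rk M ((S \ {s₁, s₂, m}) ∪ Z) ≤ rk M (gr M) :=
      rk_le_rk_gr (union_subset ((sdiff_subset (s := S) (t := {s₁, s₂, m})).trans hS) hZ)
    omega

/-! ### Pair labels from a spanning witness -/

/-- **The pair label `{a, k}`**: for `a ∈ {s₁, s₂}`, `k ∈ K` and a set `Z` with `K − k + s₁ + Z` spanning,
`(S ∖ {a, k}) ∪ Z ⊇ (K − k) + a' + Z` spans, `a'` the other point of the parallel pair. -/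
theorem pair_mem_filter_of_rk_insert_eq_four (hR : rk M (gr M) = 4) (hll : ∀ x ∈ gr M, rk M {x} = 1)
    {S : Finset α} (hS : S ⊆ gr M) {s₁ s₂ : α} (hs₁ : s₁ ∈ S) (hs₂ : s₂ ∈ S) (hne : s₁ ≠ s₂)
    (hpar : rk M {s₁, s₂} ≤ 1) {a k : α} (ha : a ∈ ({s₁, s₂} : Finset α)) (hk : k ∈ S \ {s₁, s₂})
    {Z : Finset α} (hZ : Z ⊆ gr M) (hrk : rk M (insert s₁ ((S \ {s₁, s₂}).erase k ∪ Z)) = 4) :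
    {a, k} ∈ (S.powersetCard 2).filter (fun A => rk M ((S \ A) ∪ Z) = 4) := by
  rw [mem_filter, mem_powersetCard]
  have hkS : k ∈ S := (mem_sdiff.1 hk).1
  have hk12 : k ∉ ({s₁, s₂} : Finset α) := (mem_sdiff.1 hk).2
  have haS : a ∈ S := by
    rw [mem_insert, mem_singleton] at ha
    rcases ha with h | h <;> rw [h] <;> assumption
  have hak : a ≠ k := fun h => hk12 (h ▸ ha)
  refine ⟨⟨insert_subset haS (singleton_subset_iff.2 hkS), card_pair hak⟩, ?_⟩
  obtain ⟨a', ha', ha'a⟩ : ∃ a' ∈ ({s₁, s₂} : Finset α), a' ≠ a := by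
    rw [mem_insert, mem_singleton] at ha
    rcases ha with h | h
    · exact ⟨s₂, mem_insert_of_mem (mem_singleton_self _), by rw [h]; exact hne.symm⟩
    · exact ⟨s₁, mem_insert_self _ _, by rw [h]; exact hne⟩
  have ha'S : a' ∈ S := by
    rw [mem_insert, mem_singleton] at ha'
    rcases ha' with h | h <;> rw [h] <;> assumption
  have ha'k : a' ≠ k := fun h => hk12 (h ▸ ha')
  have hsub : insert a' ((S \ {s₁, s₂}).erase k ∪ Z) ⊆ (S \ {a, k}) ∪ Z := by
    intro x hx
    rw [mem_insert, mem_union, mem_erase, mem_sdiff] at hx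
    rw [mem_union, mem_sdiff, mem_insert, mem_singleton, not_or]
    rcases hx with h | ⟨hxk, hxS, hx12⟩ | hxZ
    · rw [h]; exact Or.inl ⟨ha'S, ha'a, ha'k⟩
    · exact Or.inl ⟨hxS, fun h => hx12 (h ▸ ha), hxk⟩
    · exact Or.inr hxZ
  have h1 := rk_mono' (M := M) hsub
  have hpar' : rk M {a', s₁} ≤ 1 := by
    rw [mem_insert, mem_singleton] at ha'
    rcases ha' with h | h
    · rw [h, insert_eq_of_mem (mem_singleton_self s₁)]
      exact (hll s₁ (hS hs₁)).le
    · rw [h, pair_comm]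
      exact hpar
  have h2 := rk_insert_eq_of_parallel hll (hS ha'S) (hS hs₁) hpar' (X := (S \ {s₁, s₂}).erase k ∪ Z)
    (union_subset ((erase_subset _ _).trans ((sdiff_subset (s := S) (t := {s₁, s₂})).trans hS)) hZ)
  have h3 : rk M ((S \ {a, k}) ∪ Z) ≤ rk M (gr M) :=
    rk_le_rk_gr (union_subset ((sdiff_subset (s := S) (t := {a, k})).trans hS) hZ)
  omega

/-- The four pairs `{a, k}`, `a ∈ {s₁, s₂}`, `k ∈ {m, m'}` are distinct. -/
theorem card_image_pair_eq_four {S : Finset α} {s₁ s₂ : α} (hne : s₁ ≠ s₂) {m m' : α}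
    (hm : m ∈ S \ {s₁, s₂}) (hm' : m' ∈ S \ {s₁, s₂}) (hmm' : m ≠ m') :
    ((({s₁, s₂} : Finset α) ×ˢ ({m, m'} : Finset α)).image
      (fun p : α × α => ({p.1, p.2} : Finset α))).card = 4 := by
  have hK : ∀ x ∈ ({m, m'} : Finset α), x ∉ ({s₁, s₂} : Finset α) := by
    intro x hx
    rw [mem_insert, mem_singleton] at hx
    rcases hx with h | h
    · rw [h]; exact (mem_sdiff.1 hm).2
    · rw [h]; exact (mem_sdiff.1 hm').2
  rw [card_image_of_injOn, card_product, card_pair hne, card_pair hmm']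
  rintro ⟨a, k⟩ hp ⟨a', k'⟩ hq hpq
  rw [mem_coe, mem_product] at hp hq
  simp only at hp hq hpq
  have hak : a ∈ ({a', k'} : Finset α) := by rw [← hpq]; exact mem_insert_self _ _
  have hkk : k ∈ ({a', k'} : Finset α) := by rw [← hpq]; exact mem_insert_of_mem (mem_singleton_self _)
  have haa' : a = a' := by
    rw [mem_insert, mem_singleton] at hak
    rcases hak with h | h
    · exact h
    · exact absurd (h ▸ hp.1) (hK k' hq.2)
  have hkk' : k = k' := by
    rw [mem_insert, mem_singleton] at hkk
    rcases hkk with h | h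
    · exact absurd (h ▸ hq.1) (hK k hp.2)
    · exact h
  rw [haa', hkk']

/-- **Four pair labels**: two points `m ≠ m'` of `K` with `K − m + s₁ + Z` and `K − m' + s₁ + Z` spanning give
the four labels `{a, k}`, `a ∈ {s₁, s₂}`, `k ∈ {m, m'}`. -/
theorem four_le_card_filter_pair_of_witnesses (hR : rk M (gr M) = 4) (hll : ∀ x ∈ gr M, rk M {x} = 1)
    {S : Finset α} (hS : S ⊆ gr M) {s₁ s₂ : α} (hs₁ : s₁ ∈ S) (hs₂ : s₂ ∈ S) (hne : s₁ ≠ s₂)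
    (hpar : rk M {s₁, s₂} ≤ 1) {m m' : α} (hm : m ∈ S \ {s₁, s₂}) (hm' : m' ∈ S \ {s₁, s₂}) (hmm' : m ≠ m')
    {Z : Finset α} (hZ : Z ⊆ gr M) (h1 : rk M (insert s₁ ((S \ {s₁, s₂}).erase m ∪ Z)) = 4)
    (h2 : rk M (insert s₁ ((S \ {s₁, s₂}).erase m' ∪ Z)) = 4) :
    4 ≤ ((S.powersetCard 2).filter (fun A => rk M ((S \ A) ∪ Z) = 4)).card := by
  have hsub : ((({s₁, s₂} : Finset α) ×ˢ ({m, m'} : Finset α)).image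
      (fun p : α × α => ({p.1, p.2} : Finset α))) ⊆
      (S.powersetCard 2).filter (fun A => rk M ((S \ A) ∪ Z) = 4) := by
    intro A hA
    rw [mem_image] at hA
    obtain ⟨⟨a, k⟩, hp, rfl⟩ := hA
    rw [mem_product] at hp
    simp only at hp
    rcases mem_insert.1 hp.2 with hk | hk
    · rw [hk]
      exact pair_mem_filter_of_rk_insert_eq_four hR hll hS hs₁ hs₂ hne hpar hp.1 hm hZ h1
    · rw [mem_singleton.1 hk]
      exact pair_mem_filter_of_rk_insert_eq_four hR hll hS hs₁ hs₂ hne hpar hp.1 hm' hZ h2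
  calc 4 = _ := (card_image_pair_eq_four hne hm hm' hmm').symm
    _ ≤ _ := card_le_card hsub

/-- **Five pair labels**: the four of `four_le_card_filter_pair_of_witnesses` together with `{s₁, s₂}` when
`K + Z` spans. -/
theorem five_le_card_filter_pair_of_witnesses (hR : rk M (gr M) = 4) (hll : ∀ x ∈ gr M, rk M {x} = 1)
    {S : Finset α} (hS : S ⊆ gr M) {s₁ s₂ : α} (hs₁ : s₁ ∈ S) (hs₂ : s₂ ∈ S) (hne : s₁ ≠ s₂)
    (hpar : rk M {s₁, s₂} ≤ 1) {m m' : α} (hm : m ∈ S \ {s₁, s₂}) (hm' : m' ∈ S \ {s₁, s₂}) (hmm' : m ≠ m')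
    {Z : Finset α} (hZ : Z ⊆ gr M) (h1 : rk M (insert s₁ ((S \ {s₁, s₂}).erase m ∪ Z)) = 4)
    (h2 : rk M (insert s₁ ((S \ {s₁, s₂}).erase m' ∪ Z)) = 4)
    (h0 : rk M ((S \ {s₁, s₂}) ∪ Z) = 4) :
    5 ≤ ((S.powersetCard 2).filter (fun A => rk M ((S \ A) ∪ Z) = 4)).card := by
  have hsub : insert ({s₁, s₂} : Finset α) ((({s₁, s₂} : Finset α) ×ˢ ({m, m'} : Finset α)).image
      (fun p : α × α => ({p.1, p.2} : Finset α))) ⊆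
      (S.powersetCard 2).filter (fun A => rk M ((S \ A) ∪ Z) = 4) := by
    intro A hA
    rw [mem_insert] at hA
    rcases hA with h | hA
    · rw [h, mem_filter, mem_powersetCard]
      exact ⟨⟨insert_subset hs₁ (singleton_subset_iff.2 hs₂), card_pair hne⟩, h0⟩
    · rw [mem_image] at hA
      obtain ⟨⟨a, k⟩, hp, rfl⟩ := hA
      rw [mem_product] at hp
      simp only at hp
      rcases mem_insert.1 hp.2 with hk | hk
      · rw [hk]
        exact pair_mem_filter_of_rk_insert_eq_four hR hll hS hs₁ hs₂ hne hpar hp.1 hm hZ h1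
      · rw [mem_singleton.1 hk]
        exact pair_mem_filter_of_rk_insert_eq_four hR hll hS hs₁ hs₂ hne hpar hp.1 hm' hZ h2
  have hnot : ({s₁, s₂} : Finset α) ∉ ((({s₁, s₂} : Finset α) ×ˢ ({m, m'} : Finset α)).image
      (fun p : α × α => ({p.1, p.2} : Finset α))) := by
    rw [mem_image]
    rintro ⟨⟨a, k⟩, hp, hpq⟩
    rw [mem_product] at hp
    simp only at hp hpq
    have hk : k ∈ ({s₁, s₂} : Finset α) := by
      rw [← hpq]; exact mem_insert_of_mem (mem_singleton_self _)
    rcases mem_insert.1 hp.2 with h | h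
    · exact (mem_sdiff.1 hm).2 (h ▸ hk)
    · exact (mem_sdiff.1 hm').2 ((mem_singleton.1 h) ▸ hk)
  calc 5 = _ := by rw [card_insert_of_notMem hnot, card_image_pair_eq_four hne hm hm' hmm']
    _ ≤ _ := card_le_card hsub

/-- A spanning witness `K − m + s₁ + y` spans `K − m + s₁ + Z` for every `Z ∋ y`. -/
theorem rk_insert_erase_union_eq_four (hR : rk M (gr M) = 4) {S : Finset α} (hS : S ⊆ gr M) {s₁ s₂ : α}
    (hs₁ : s₁ ∈ S) {m y : α} (hym : rk M (insert y (insert s₁ ((S \ {s₁, s₂}).erase m))) = 4)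
    {Z : Finset α} (hZ : Z ⊆ gr M) (hyZ : y ∈ Z) :
    rk M (insert s₁ ((S \ {s₁, s₂}).erase m ∪ Z)) = 4 := by
  have hsub : insert y (insert s₁ ((S \ {s₁, s₂}).erase m)) ⊆ insert s₁ ((S \ {s₁, s₂}).erase m ∪ Z) := by
    intro x hx
    rw [mem_insert, mem_insert] at hx
    rw [mem_insert, mem_union]
    rcases hx with h | h | h
    · rw [h]; exact Or.inr (Or.inr hyZ)
    · exact Or.inl h
    · exact Or.inr (Or.inl h)
  have h1 := rk_mono' (M := M) hsub
  have h2 : rk M (insert s₁ ((S \ {s₁, s₂}).erase m ∪ Z)) ≤ rk M (gr M) :=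
    rk_le_rk_gr (insert_subset (hS hs₁)
      (union_subset ((erase_subset _ _).trans ((sdiff_subset (s := S) (t := {s₁, s₂})).trans hS)) hZ))
  omega

/-! ### Lines through `s₁` -/

/-- **A unique spanning witness puts `y` on the line `cl{s₁, m}`**: if `K − k + s₁ + y` fails to span for both
`k ∈ K − m`, then `ρ{y, s₁, m} ≤ 2`. -/
theorem rk_insert_pair_le_two_of_unique (hR : rk M (gr M) = 4) (hll : ∀ x ∈ gr M, rk M {x} = 1) {S : Finset α}
    (hS : S ⊆ gr M) (hS5 : S.card = 5) (hSsp : rk M S = 4) {s₁ s₂ : α} (hs₁ : s₁ ∈ S) (hs₂ : s₂ ∈ S)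
    (hne : s₁ ≠ s₂) (hpar : rk M {s₁, s₂} ≤ 1) {y m : α} (hm : m ∈ S \ {s₁, s₂})
    (huniq : ∀ k ∈ S \ {s₁, s₂}, k ≠ m → rk M (insert y (insert s₁ ((S \ {s₁, s₂}).erase k))) ≤ 3) :
    rk M (insert y {s₁, m}) ≤ 2 := by
  have hKm : ((S \ {s₁, s₂}).erase m).card = 2 := by
    rw [card_erase_of_mem hm, card_sdiff_pair hS5 hs₁ hs₂ hne]
  obtain ⟨k, l, hkl, hkl_eq⟩ := card_eq_two.1 hKm
  have hk : k ∈ (S \ {s₁, s₂}).erase m := by rw [hkl_eq]; exact mem_insert_self _ _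
  have hl : l ∈ (S \ {s₁, s₂}).erase m := by rw [hkl_eq]; exact mem_insert_of_mem (mem_singleton_self _)
  have hH := four_add_rk_insert_pair_le hR hll hS hSsp hs₁ hs₂ hpar hm hkl (ne_of_mem_erase hk).symm
    (ne_of_mem_erase hl).symm y
  have h1 := huniq k (mem_of_mem_erase hk) (ne_of_mem_erase hk)
  have h2 := huniq l (mem_of_mem_erase hl) (ne_of_mem_erase hl)
  omega

/-- Two points on the line `cl{s₁, m}` span with `s₁` a set of rank `≤ 2`. -/
theorem rk_insert_pair_le_two_of_same_line (hR : rk M (gr M) = 4) (hll : ∀ x ∈ gr M, rk M {x} = 1)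
    {S : Finset α} (hS : S ⊆ gr M) (hS5 : S.card = 5) (hSsp : rk M S = 4) {s₁ s₂ : α} (hs₁ : s₁ ∈ S)
    (hs₂ : s₂ ∈ S) (hne : s₁ ≠ s₂) (hpar : rk M {s₁, s₂} ≤ 1) {y y' m : α} (hm : m ∈ S \ {s₁, s₂})
    (hy2 : rk M (insert y {s₁, m}) ≤ 2) (hy'2 : rk M (insert y' {s₁, m}) ≤ 2) :
    rk M (insert s₁ {y, y'}) ≤ 2 := by
  have h := rk_union_add_rk_inter_le (M := M) (insert y {s₁, m}) (insert y' {s₁, m})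
  have hu : insert s₁ ({y, y'} : Finset α) ⊆ insert y {s₁, m} ∪ insert y' {s₁, m} := by
    intro x hx
    rw [mem_insert, mem_insert, mem_singleton] at hx
    rw [mem_union, mem_insert, mem_insert, mem_singleton, mem_insert, mem_insert, mem_singleton]
    rcases hx with h | h | h
    · exact Or.inl (Or.inr (Or.inl h))
    · exact Or.inl (Or.inl h)
    · exact Or.inr (Or.inl h)
  have hi : ({s₁, m} : Finset α) ⊆ insert y {s₁, m} ∩ insert y' {s₁, m} := by
    intro x hx
    exact mem_inter.2 ⟨mem_insert_of_mem hx, mem_insert_of_mem hx⟩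
  have h1 := rk_mono' (M := M) hu
  have h2 := rk_mono' (M := M) hi
  have hm1 : m ≠ s₁ := fun h => (mem_sdiff.1 hm).2 (h ▸ mem_insert_self _ _)
  have h3 : rk M {s₁, m} = 2 := by
    rw [rk_eq_card_of_subset_insert_sdiff_pair hR hll hS hS5 hSsp hs₁ hs₂ hne hpar
      (insert_subset (mem_insert_self _ _) (singleton_subset_iff.2 (mem_insert_of_mem hm))), card_pair hm1.symm]
  omega

/-- **Two non-bad points on one line and a bad point form a dependent triple**: `ρ{z, y, y'} = ρ(s₁ + {y, y'}) ≤ 2`. -/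
theorem rk_triple_le_two_of_same_line (hll : ∀ x ∈ gr M, rk M {x} = 1) {s₁ z y y' : α} (hs₁ : s₁ ∈ gr M)
    (hz : z ∈ gr M) (hy : y ∈ gr M) (hy' : y' ∈ gr M) (hzb : rk M {s₁, z} ≤ 1)
    (hline : rk M (insert s₁ {y, y'}) ≤ 2) : rk M {z, y, y'} ≤ 2 := by
  have h1 := rk_insert_eq_of_parallel hll hz hs₁ (by rw [pair_comm]; exact hzb)
    (X := {y, y'}) (insert_subset hy (singleton_subset_iff.2 hy'))
  rw [h1]
  exact hline

/-- **Two non-bad points on different lines through `s₁` are independent**: if `y ∈ cl{s₁, m}`, `y' ∈ cl{s₁, m'}`,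
`m ≠ m'`, and `y'` is not bad, then `ρ{y, y'} = 2` (a parallel `y'` would lie on both lines, hence on `cl{s₁}`). -/
theorem rk_pair_eq_two_of_different_lines (hR : rk M (gr M) = 4) (hll : ∀ x ∈ gr M, rk M {x} = 1)
    {S : Finset α} (hS : S ⊆ gr M) (hS5 : S.card = 5) (hSsp : rk M S = 4) {s₁ s₂ : α} (hs₁ : s₁ ∈ S)
    (hs₂ : s₂ ∈ S) (hne : s₁ ≠ s₂) (hpar : rk M {s₁, s₂} ≤ 1) {y y' m m' : α} (hy : y ∈ gr M)
    (hy' : y' ∈ gr M) (hm : m ∈ S \ {s₁, s₂}) (hm' : m' ∈ S \ {s₁, s₂}) (hmm' : m ≠ m')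
    (hy2 : rk M (insert y {s₁, m}) ≤ 2) (hy'2 : rk M (insert y' {s₁, m'}) ≤ 2) (hy'b : ¬ rk M {s₁, y'} ≤ 1) :
    rk M {y, y'} = 2 := by
  have hle : rk M {y, y'} ≤ 2 := (rk_le_card _).trans card_le_two
  by_contra hcon
  have hdep : rk M {y', y} ≤ 1 := by rw [pair_comm]; omega
  -- `y'` lies on the line `cl{s₁, m}` as well
  have hy'm : rk M (insert y' {s₁, m}) ≤ 2 := by
    rw [rk_insert_eq_of_parallel hll hy' hy hdep
      (insert_subset (hS hs₁) (singleton_subset_iff.2 (hS (mem_sdiff.1 hm).1)))]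
    exact hy2
  have h := rk_union_add_rk_inter_le (M := M) (insert y' {s₁, m}) (insert y' {s₁, m'})
  have hu : ({s₁, m, m'} : Finset α) ⊆ insert y' {s₁, m} ∪ insert y' {s₁, m'} := by
    intro x hx
    rw [mem_insert, mem_insert, mem_singleton] at hx
    rw [mem_union, mem_insert, mem_insert, mem_singleton, mem_insert, mem_insert, mem_singleton]
    rcases hx with h | h | h
    · exact Or.inl (Or.inr (Or.inl h))
    · exact Or.inl (Or.inr (Or.inr h))
    · exact Or.inr (Or.inr (Or.inr h))
  have hi : ({s₁, y'} : Finset α) ⊆ insert y' {s₁, m} ∩ insert y' {s₁, m'} := by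
    intro x hx
    rw [mem_insert, mem_singleton] at hx
    rw [mem_inter, mem_insert, mem_insert, mem_singleton, mem_insert, mem_insert, mem_singleton]
    rcases hx with h | h
    · exact ⟨Or.inr (Or.inl h), Or.inr (Or.inl h)⟩
    · exact ⟨Or.inl h, Or.inl h⟩
  have h1 := rk_mono' (M := M) hu
  have h2 := rk_mono' (M := M) hi
  have hm1 : m ≠ s₁ := fun h => (mem_sdiff.1 hm).2 (h ▸ mem_insert_self _ _)
  have hm'1 : m' ≠ s₁ := fun h => (mem_sdiff.1 hm').2 (h ▸ mem_insert_self _ _)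
  have h3 : rk M {s₁, m, m'} = 3 := by
    rw [rk_eq_card_of_subset_insert_sdiff_pair hR hll hS hS5 hSsp hs₁ hs₂ hne hpar ?_]
    · rw [card_insert_of_notMem, card_pair hmm']
      rw [mem_insert, mem_singleton, not_or]
      exact ⟨hm1.symm, hm'1.symm⟩
    · intro x hx
      rw [mem_insert, mem_insert, mem_singleton] at hx
      rcases hx with h | h | h
      · rw [h]; exact mem_insert_self _ _
      · rw [h]; exact mem_insert_of_mem hm
      · rw [h]; exact mem_insert_of_mem hm'
  exact hy'b (by omega)

end StarStarD

end PercRepro.Cogirth
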